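/-
Copyright (c) 2026 the pub-hodgecm-mathlib formalisation cell (harness21).  Prover seat hodgecm-mathlib-F0P2-p10 (g4), Track B ∕ R90-TF, h413 = `stmt-HodgeConjecture-24833`,
R90-TF section S8 «ContSpec-n½», socket (E) :276, E1-PLANCHEREL BODY brick PB-1c-0 (S8 dealer R90-CS-plan (g4) S8-R269 (2); joint census `R90/S8/CENSUS-PlancherelBody-bricks.K2E1-p16-F0P2-p10.md` §PB-1):
the SCALAR SHELL of the intertwined (`w = w₀`) bracket of MW's inner-product formula II.2.1 for `U(2,1)`: Parseval II at the `N = 3` weight `r^{−3}` with the parametric integral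
`(M₃g)(r) = (2π)⁻¹∫ g̃(w)·c(w)·r^{2−w} dy′`, and the full `N = 3` Mellin side `∫ f·conj(g + a•M₃g)·r^{−3} = (2π)⁻¹∫ f̃(z)·(conj g̃(2 − z̄) + a·c(z)·conj g̃(z̄)) dy`.
-/
import Summits.HodgeConjecture.HodgeConjecture.Theorems.K2E1ChiPseudoEisensteinBracketOneMellinCMThree   -- ★ PB-1b-ii p865252 §1 `setIntegral_mul_conj_mul_cpow_neg_three_eq` (N = 3 Parseval I); brings ★ A `K2E1MellinPaleyWienerHalfLine`
import Summits.HodgeConjecture.HodgeConjecture.Theorems.K2E1PseudoEisensteinInnerProductCMTwo            -- ★ N = 2 Mellin side `setIntegral_radialPairing_mul_cpow_eq`, `continuousAt_integral_mellin_mul_cpow`, `continuous_mul_of_continuousAt_Ioi`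
import HarnessLib

/-!
# PB-1c-0 — `K2E1MellinParsevalIntertwinedCMThree`: PARSEVAL II AND THE MELLIN SIDE OF MW II.2.1 AT THE `N = 3` WEIGHT `r^{−3}`

Track B ∕ R90-TF, crux h413 = `stmt-HodgeConjecture-24833`, route of record `HCCMUnconditional`; cell `hodgecm-mathlib`, R90-TF programme, section S8 «ContSpec-n½», socket (E)
(B ED. 7 :276): the E1-PLANCHEREL BODY cut into bricks PB-1…PB-4 (S8-R254).  ★ PB-1a p865168: `⟨θ_{f,φ}, θ_{f′,φ′}⟩_X = c_μ·([Ψ₁]_β + [Ψ₂]_β)`; ★ PB-1b p865195 + p865252: the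
DIAGONAL bracket `[Ψ₁]_β` as a Mellin line integral (`N = 3` Parseval I, shift `z̄ − 2`).  THIS FILE is the SCALAR SHELL of the INTERTWINED bracket `[Ψ₂]_β` (PB-1c): pure analysis
on `(0,∞)`, hypothesis-first on a continuous bounded scalar `c` on the line `Re z = σ₀` (for PB-1c proper `c(z) = ⟪φ, M(w₀,z)φ′⟩_{K_U}`, the PB-2 owner's analytic input).
THEOREMS ONLY (no `def`, no `instance`, no notation, no named-fact hypothesis, no `sorry`; default heartbeats); lane `--supports stmt-HodgeConjecture-24833 --as helper` (count-neutral).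

THE MATHEMATICS ([MoeglinWaldspurger1995] II.1.4, II.2.1; [Titchmarsh1948] Thm 71–72).  For `U(2,1)` (`ρ_P = 1` in the `H^z` convention) the constant term of `E(z)` is
`H^z φ + M(w₀,z) H^{2−z} φ`, so the intertwined part of a pseudo-Eisenstein constant term is the parametric integral `(M₃g)(r) := (2π)⁻¹∫ g̃(w)·c(w)·r^{2−w} dy′` (`w = σ₀+iy′`),
against `(M₂g)(r) = (2π)⁻¹∫ g̃(w)·c(w)·r^{1−w} dy′` at `N = 2` (★ A Parseval II `K2E1MellinPaleyWienerHalfLine.setIntegral_mul_cpow_mul_conj_integral_eq`, weight `r^{−2}`).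
KEY REMARK (§1): `r^{2−w} = r^{1−w}·r` for `r > 0`, hence `(M₃g)(r) = (M₂g)(r)·r` and **`f(r)·r^{−3}·conj (M₃g)(r) = f(r)·r^{−2}·conj (M₂g)(r)` pointwise on `(0,∞)`** — so
* §2 **PARSEVAL II AT `N = 3`**: `∫_0^∞ f(r)·r^{−3}·conj (M₃g)(r) dr = (2π)⁻¹ ∫_ℝ f̃(z)·conj g̃(z̄)·conj c(z̄) dy` (`f ∈ C_c((0,∞))`, `g ∈ C²_c((0,∞))`, any `σ₀`; `f̃ = mellin f (−·)`) is ★ A Parseval II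
  after `setIntegral_congr_fun` — no new shift on the Mellin side;
* §3 **THE `N = 3` MELLIN SIDE** (twin of ★ `K2E1PseudoEisensteinInnerProductCMTwo.setIntegral_radialPairing_mul_cpow_eq`): for `f, g ∈ C²_c((0,∞))`, `σ₀ ≥ 1`, `a ∈ ℝ`, `c` continuous bounded
  on the line with the reflection `conj c(z̄) = c(z)`: `∫_0^∞ f·conj(g + a•M₃g)·r^{−3} dr = (2π)⁻¹∫_ℝ f̃(z)·(conj (mellin g (z̄ − 2)) + a·c(z)·conj g̃(z̄)) dy` — ★ p865252 §1 (Parseval I at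
  `r^{−3}`) plus `a` times §2, the splitting justified by `f·conj g·r^{−3}, f·r^{−3}·conj M₃g ∈ L¹((0,∞))` and by the integrability of both line integrands (★ A `verticalIntegrable_mellin`,
  `norm_mellin_le`).

HONEST LABEL.  Scalar shell only: the operator-valued bracket `[Ψ₂]_β` (PB-1c proper) and the contour shift (PB-2) are untouched.  HC_CM is proved only modulo the 7 printed citations
(2 remaining named inputs: hLiu418 = `stmt-HodgeConjecture-24832`, h413 = `stmt-HodgeConjecture-24833`) until rung 0 closes; this file pays nothing at the (E) socket; count-neutral.
-/

set_option autoImplicit false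
set_option linter.dupNamespace false  -- the mandated namespace repeats the summit's segment (`HodgeConjecture.HodgeConjecture`)

noncomputable section

open MeasureTheory Measure Set Filter Topology Complex
open scoped Real NNReal ENNReal ComplexConjugate
open Summit.HodgeConjecture.HodgeConjecture.Cruxes.H413.K2E1MellinPaleyWienerHalfLine (setIntegral_mul_cpow_mul_conj_integral_eq differentiable_mellin verticalIntegrable_mellin norm_mellin_le
  integrable_ofReal_cpow_mul)
open Summit.HodgeConjecture.HodgeConjecture.Cruxes.H413.K2E1PseudoEisensteinInnerProductCMTwo (continuousAt_integral_mellin_mul_cpow continuous_mul_of_continuousAt_Ioi)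
open Summit.HodgeConjecture.HodgeConjecture.Cruxes.H413.K2E1ChiPseudoEisensteinBracketOneMellinCMThree (setIntegral_mul_conj_mul_cpow_neg_three_eq)

namespace Summit.HodgeConjecture.HodgeConjecture.Cruxes.H413.K2E1MellinParsevalIntertwinedCMThree

variable {f g : ℝ → ℂ}

/-! ## §1 The key remark: `r^{2−w} = r^{1−w}·r`, `M₃g = M₂g·r`, and the pointwise identity of the two integrands -/

/-- `r^{2−w} = r^{1−w}·r` for `r > 0`. [folklore] -/
theorem cpow_two_sub_eq {r : ℝ} (hr : 0 < r) (w : ℂ) : (r : ℂ) ^ (2 - w) = (r : ℂ) ^ (1 - w) * r := by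
  have hr0 : (r : ℂ) ≠ 0 := Complex.ofReal_ne_zero.2 hr.ne'
  rw [show (2 : ℂ) - w = (1 - w) + 1 by ring, Complex.cpow_add _ _ hr0, Complex.cpow_one]

/-- `r^{−3}·r = r^{−2}` for `r > 0`. [folklore] -/
theorem cpow_neg_three_mul_self_eq {r : ℝ} (hr : 0 < r) : (r : ℂ) ^ (-3 : ℂ) * r = (r : ℂ) ^ (-2 : ℂ) := by
  have hr0 : (r : ℂ) ≠ 0 := Complex.ofReal_ne_zero.2 hr.ne'
  rw [show (-2 : ℂ) = -3 + 1 by norm_num, Complex.cpow_add _ _ hr0, Complex.cpow_one]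

/-- **`(M₃g)(r) = (M₂g)(r)·r`** for `r > 0`: `∫ G(y)·c(z)·r^{2−z} dy = (∫ G(y)·c(z)·r^{1−z} dy)·r` (`z = σ₀+iy`; any `G`, `c`). [cite: MoeglinWaldspurger1995, II.1.4] -/
theorem integral_mul_cpow_two_sub_eq (G : ℝ → ℂ) (c : ℂ → ℂ) (σ₀ : ℝ) {r : ℝ} (hr : 0 < r) :
    ∫ y : ℝ, G y * c ((σ₀ : ℂ) + y * I) * (r : ℂ) ^ (2 - ((σ₀ : ℂ) + y * I)) = (∫ y : ℝ, G y * c ((σ₀ : ℂ) + y * I) * (r : ℂ) ^ (1 - ((σ₀ : ℂ) + y * I))) * r := by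
  rw [← integral_mul_const]
  refine integral_congr_ae (Eventually.of_forall fun y => ?_)
  simp only [cpow_two_sub_eq hr]
  ring

/-- **THE POINTWISE IDENTITY**: `f(r)·r^{−3}·conj(κ·(M₃g)(r)) = f(r)·r^{−2}·conj(κ·(M₂g)(r))` for `r > 0` (`conj r = r`). [cite: MoeglinWaldspurger1995, II.2.1] -/
theorem mul_cpow_neg_three_mul_conj_eq (f G : ℝ → ℂ) (c : ℂ → ℂ) (κ : ℂ) (σ₀ : ℝ) {r : ℝ} (hr : 0 < r) :
    f r * (r : ℂ) ^ (-3 : ℂ) * conj (κ * ∫ y : ℝ, G y * c ((σ₀ : ℂ) + y * I) * (r : ℂ) ^ (2 - ((σ₀ : ℂ) + y * I))) =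
      f r * (r : ℂ) ^ (-2 : ℂ) * conj (κ * ∫ y : ℝ, G y * c ((σ₀ : ℂ) + y * I) * (r : ℂ) ^ (1 - ((σ₀ : ℂ) + y * I))) := by
  rw [integral_mul_cpow_two_sub_eq G c σ₀ hr, ← mul_assoc κ, map_mul, Complex.conj_ofReal, ← cpow_neg_three_mul_self_eq hr]
  ring

/-! ## §2 HEAD-a: Parseval II at the `N = 3` weight -/

/-- **PARSEVAL II AT `N = 3`** (the `w = w₀` term of MW II.2.1 for `U(2,1)`): for `f ∈ C_c((0,∞))`, `g ∈ C²_c((0,∞))`, any `σ₀`, and a coefficient `c` continuous and bounded on the line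
`Re = σ₀`, with `(M₃g)(r) := (2π)⁻¹∫ g̃(w)·c(w)·r^{2−w} dy′` (`w = σ₀+iy′`, `g̃ = mellin g (−·)`):
**`∫_0^∞ f(r)·r^{−3}·conj (M₃g)(r) dr = (2π)⁻¹ ∫_ℝ f̃(z)·conj g̃(z̄)·conj c(z̄) dy`** (`z = σ₀+iy`) — ★ A Parseval II (`K2E1MellinPaleyWienerHalfLine.setIntegral_mul_cpow_mul_conj_integral_eq`, weight `r^{−2}`,
`r^{1−w}`) after the pointwise identity §1. [cite: MoeglinWaldspurger1995, II.2.1] [cite: Titchmarsh1948, Thm 71–72] -/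
theorem setIntegral_mul_cpow_neg_three_mul_conj_integral_eq (hfc : Continuous f) (hfs : HasCompactSupport f) (hf0 : tsupport f ⊆ Ioi 0)
    (hg : ContDiff ℝ 2 g) (hgs : HasCompactSupport g) (hg0 : tsupport g ⊆ Ioi 0) (σ₀ : ℝ)
    {c : ℂ → ℂ} (hcc : Continuous fun y : ℝ => c ((σ₀ : ℂ) + y * I)) {C₀ : ℝ} (hcb : ∀ y : ℝ, ‖c ((σ₀ : ℂ) + y * I)‖ ≤ C₀) :
    ∫ r in Ioi (0 : ℝ), f r * (r : ℂ) ^ (-3 : ℂ) *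
        conj ((((2 * π)⁻¹ : ℝ) : ℂ) * ∫ y : ℝ, mellin g (-((σ₀ : ℂ) + y * I)) * c ((σ₀ : ℂ) + y * I) * (r : ℂ) ^ (2 - ((σ₀ : ℂ) + y * I))) =
      (((2 * π)⁻¹ : ℝ) : ℂ) * ∫ y : ℝ, mellin f (-((σ₀ : ℂ) + y * I)) * conj (mellin g (-conj ((σ₀ : ℂ) + y * I))) * conj (c (conj ((σ₀ : ℂ) + y * I))) := by
  rw [← setIntegral_mul_cpow_mul_conj_integral_eq hfc hfs hf0 hg hgs hg0 σ₀ hcc hcb]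
  exact setIntegral_congr_fun measurableSet_Ioi fun r hr => mul_cpow_neg_three_mul_conj_eq f (fun y : ℝ => mellin g (-((σ₀ : ℂ) + y * I))) c _ σ₀ hr

/-! ## §3 HEAD-b: the `N = 3` Mellin side of MW II.2.1 (Parseval I + `a`·Parseval II at `r^{−3}`) -/

/-- **THE MELLIN SIDE OF MW II.2.1 FOR `U(2,1)`.**  For `f, g ∈ C²_c((0,∞))`, `σ₀ ≥ 1`, a real scalar `a` and a coefficient `c` continuous and bounded on `Re z = σ₀` with the reflection
`conj c(z̄) = c(z)` there, put `(M₃g)(r) := (2π)⁻¹∫_ℝ g̃(z)·c(z)·r^{2−z} dy` (`z = σ₀+iy`, `g̃ = mellin g (−·)`).  Then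
**`∫_0^∞ f(r)·conj(g(r) + a•(M₃g)(r))·r^{−3} dr = (2π)⁻¹ ∫_ℝ f̃(z)·(conj (mellin g (z̄ − 2)) + a·c(z)·conj g̃(z̄)) dy`** — ★ PB-1b-ii §1 Parseval I at `r^{−3}` (`w = 1` term, shift `z̄ − 2`)
plus `a` times §2 Parseval II at `r^{−3}` (`w = w₀` term), the splitting justified by `f·conj g·r^{−3}, f·r^{−3}·conj M₃g ∈ L¹((0,∞))` (§1: the second is `f·r^{−2}·conj M₂g`, continuous of
compact support by ★ `continuousAt_integral_mellin_mul_cpow`) and by the integrability of both line integrands (★ A).  The `N = 3` twin of ★ `setIntegral_radialPairing_mul_cpow_eq`.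
[cite: MoeglinWaldspurger1995, II.2.1] [cite: Titchmarsh1948, Thm 71–72] -/
theorem setIntegral_radialPairing_mul_cpow_neg_three_eq (hf : ContDiff ℝ 2 f) (hfs : HasCompactSupport f) (hf0 : tsupport f ⊆ Ioi 0)
    (hg : ContDiff ℝ 2 g) (hgs : HasCompactSupport g) (hg0 : tsupport g ⊆ Ioi 0) {σ₀ : ℝ} (hσ₀ : 1 ≤ σ₀)
    {c : ℂ → ℂ} (hcc : Continuous fun y : ℝ => c ((σ₀ : ℂ) + y * I)) {C₀ : ℝ} (hcb : ∀ y : ℝ, ‖c ((σ₀ : ℂ) + y * I)‖ ≤ C₀)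
    (hcr : ∀ y : ℝ, conj (c (conj ((σ₀ : ℂ) + y * I))) = c ((σ₀ : ℂ) + y * I)) (a : ℝ) :
    ∫ r in Ioi (0 : ℝ), f r * conj (g r + a • ((((2 * π)⁻¹ : ℝ) : ℂ) * ∫ y : ℝ, mellin g (-((σ₀ : ℂ) + y * I)) * c ((σ₀ : ℂ) + y * I) * (r : ℂ) ^ (2 - ((σ₀ : ℂ) + y * I)))) *
        (r : ℂ) ^ (-3 : ℂ) =
      (((2 * π)⁻¹ : ℝ) : ℂ) * ∫ y : ℝ, mellin f (-((σ₀ : ℂ) + y * I)) *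
        (conj (mellin g (conj ((σ₀ : ℂ) + y * I) - 2)) + (a : ℂ) * c ((σ₀ : ℂ) + y * I) * conj (mellin g (-conj ((σ₀ : ℂ) + y * I)))) := by
  set κ : ℂ := (((2 * π)⁻¹ : ℝ) : ℂ) with hκ
  set M : ℝ → ℂ := fun r => κ * ∫ y : ℝ, mellin g (-((σ₀ : ℂ) + y * I)) * c ((σ₀ : ℂ) + y * I) * (r : ℂ) ^ (2 - ((σ₀ : ℂ) + y * I)) with hM
  set M₂ : ℝ → ℂ := fun r => κ * ∫ y : ℝ, mellin g (-((σ₀ : ℂ) + y * I)) * c ((σ₀ : ℂ) + y * I) * (r : ℂ) ^ (1 - ((σ₀ : ℂ) + y * I)) with hM₂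
  -- `f̃` on the line: continuity and integrability (★ A)
  have hFc : Continuous fun y : ℝ => mellin f (-((σ₀ : ℂ) + y * I)) :=
    (differentiable_mellin hf.continuous hfs hf0).continuous.comp (by fun_prop)
  have hFi : Integrable fun y : ℝ => mellin f (-((σ₀ : ℂ) + y * I)) := by
    have h := (verticalIntegrable_mellin hf hfs hf0 (-σ₀)).comp_neg
    refine h.congr (Eventually.of_forall fun y => ?_)
    simp only [ofReal_neg]; congr 1; ring
  have hGd := differentiable_mellin hg.continuous hgs hg0
  -- (1) pointwise expansion of the integrand, and the key remark `f·r^{−3}·conj M = f·r^{−2}·conj M₂` on `(0,∞)`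
  have hexp : ∀ r : ℝ, f r * conj (g r + a • M r) * (r : ℂ) ^ (-3 : ℂ) =
      f r * conj (g r) * (r : ℂ) ^ (-3 : ℂ) + (a : ℂ) * (f r * (r : ℂ) ^ (-3 : ℂ) * conj (M r)) := fun r => by
    rw [map_add, Complex.real_smul, map_mul, conj_ofReal]; ring
  have hkey : ∀ r : ℝ, 0 < r → f r * (r : ℂ) ^ (-3 : ℂ) * conj (M r) = f r * (r : ℂ) ^ (-2 : ℂ) * conj (M₂ r) := fun r hr =>
    mul_cpow_neg_three_mul_conj_eq f (fun y : ℝ => mellin g (-((σ₀ : ℂ) + y * I))) c κ σ₀ hr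
  -- (2) integrability of the two pieces on `(0,∞)`
  have hI1 : IntegrableOn (fun r : ℝ => f r * conj (g r) * (r : ℂ) ^ (-3 : ℂ)) (Ioi 0) := by
    have h1 : Continuous fun r : ℝ => f r * conj (g r) := hf.continuous.mul (continuous_conj.comp hg.continuous)
    have h := integrable_ofReal_cpow_mul (f := fun r : ℝ => f r * conj (g r)) h1 hfs.mul_right (tsupport_mul_subset_left.trans hf0) (-3)
    exact (h.congr (Eventually.of_forall fun r => by simp only; ring)).integrableOn
  have hM₂c : ∀ r : ℝ, 0 < r → ContinuousAt M₂ r := fun r hr =>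
    continuousAt_const.mul (continuousAt_integral_mellin_mul_cpow hg hgs hg0 hσ₀ hcc hcb hr)
  have hI2 : IntegrableOn (fun r : ℝ => f r * (r : ℂ) ^ (-3 : ℂ) * conj (M r)) (Ioi 0) := by
    have h2 : Continuous fun r : ℝ => f r * ((r : ℂ) ^ (-2 : ℂ) * conj (M₂ r)) :=
      continuous_mul_of_continuousAt_Ioi hf.continuous hf0 fun r hr =>
        (continuousAt_ofReal_cpow_const r _ (Or.inr hr.ne')).mul (continuous_conj.continuousAt.comp (hM₂c r hr))
    have h : Integrable (fun r : ℝ => f r * ((r : ℂ) ^ (-2 : ℂ) * conj (M₂ r))) := h2.integrable_of_hasCompactSupport hfs.mul_right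
    have h' : IntegrableOn (fun r : ℝ => f r * (r : ℂ) ^ (-2 : ℂ) * conj (M₂ r)) (Ioi 0) :=
      (h.congr (Eventually.of_forall fun r => by simp only; ring)).integrableOn
    exact h'.congr_fun (fun r hr => (hkey r hr).symm) measurableSet_Ioi
  -- (3) integrability of the two line integrands
  have hre1 : ∀ y : ℝ, (conj ((σ₀ : ℂ) + y * I) - 2).re = σ₀ - 2 := fun y => by
    simp only [sub_re, conj_re, add_re, ofReal_re, mul_re, I_re, mul_zero, ofReal_im, I_im, mul_one, sub_self, add_zero, re_ofNat]
  have hre2 : ∀ y : ℝ, (-conj ((σ₀ : ℂ) + y * I)).re = -σ₀ := fun y => by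
    simp only [neg_re, conj_re, add_re, ofReal_re, mul_re, I_re, mul_zero, ofReal_im, I_im, mul_one, sub_self, add_zero]
  have hA : Integrable fun y : ℝ => mellin f (-((σ₀ : ℂ) + y * I)) * conj (mellin g (conj ((σ₀ : ℂ) + y * I) - 2)) := by
    refine hFi.mul_bdd (c := ∫ t in Ioi 0, t ^ (σ₀ - 2 - 1) * ‖g t‖) ?_ (Eventually.of_forall fun y => ?_)
    · exact (continuous_conj.comp (hGd.continuous.comp (by fun_prop))).aestronglyMeasurable
    · rw [RCLike.norm_conj, ← hre1 y]; exact norm_mellin_le g _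
  have hB : Integrable fun y : ℝ => mellin f (-((σ₀ : ℂ) + y * I)) *
      ((a : ℂ) * c ((σ₀ : ℂ) + y * I) * conj (mellin g (-conj ((σ₀ : ℂ) + y * I)))) := by
    refine hFi.mul_bdd (c := ‖(a : ℂ)‖ * C₀ * ∫ t in Ioi 0, t ^ (-σ₀ - 1) * ‖g t‖) ?_ (Eventually.of_forall fun y => ?_)
    · exact ((continuous_const.mul hcc).mul (continuous_conj.comp (hGd.continuous.comp (by fun_prop)))).aestronglyMeasurable
    · rw [norm_mul, norm_mul, RCLike.norm_conj]
      have h2 : ‖mellin g (-conj ((σ₀ : ℂ) + y * I))‖ ≤ ∫ t in Ioi 0, t ^ (-σ₀ - 1) * ‖g t‖ := by rw [← hre2 y]; exact norm_mellin_le g _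
      exact mul_le_mul (mul_le_mul_of_nonneg_left (hcb y) (norm_nonneg _)) h2 (norm_nonneg _) (mul_nonneg (norm_nonneg _) ((norm_nonneg _).trans (hcb 0)))
  -- (4) the two Parseval identities at `r^{−3}` (★ PB-1b-ii §1 and §2 above)
  have hP1 := setIntegral_mul_conj_mul_cpow_neg_three_eq hf hfs hf0 hg.continuous hgs hg0 σ₀
  have hP2 := setIntegral_mul_cpow_neg_three_mul_conj_integral_eq hf.continuous hfs hf0 hg hgs hg0 σ₀ hcc hcb
  -- (5) assemble
  calc ∫ r in Ioi (0 : ℝ), f r * conj (g r + a • M r) * (r : ℂ) ^ (-3 : ℂ)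
      = ∫ r in Ioi (0 : ℝ), (f r * conj (g r) * (r : ℂ) ^ (-3 : ℂ) + (a : ℂ) * (f r * (r : ℂ) ^ (-3 : ℂ) * conj (M r))) :=
        setIntegral_congr_fun measurableSet_Ioi fun r _ => hexp r
    _ = (∫ r in Ioi (0 : ℝ), f r * conj (g r) * (r : ℂ) ^ (-3 : ℂ)) + (a : ℂ) * ∫ r in Ioi (0 : ℝ), f r * (r : ℂ) ^ (-3 : ℂ) * conj (M r) := by
        rw [integral_add hI1 (hI2.const_mul _), integral_const_mul]
    _ = κ * (∫ y : ℝ, mellin f (-((σ₀ : ℂ) + y * I)) * conj (mellin g (conj ((σ₀ : ℂ) + y * I) - 2))) +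
          (a : ℂ) * (κ * ∫ y : ℝ, mellin f (-((σ₀ : ℂ) + y * I)) * conj (mellin g (-conj ((σ₀ : ℂ) + y * I))) * conj (c (conj ((σ₀ : ℂ) + y * I)))) := by
        rw [hP1, hP2]
    _ = κ * ((∫ y : ℝ, mellin f (-((σ₀ : ℂ) + y * I)) * conj (mellin g (conj ((σ₀ : ℂ) + y * I) - 2))) +
          ∫ y : ℝ, mellin f (-((σ₀ : ℂ) + y * I)) * ((a : ℂ) * c ((σ₀ : ℂ) + y * I) * conj (mellin g (-conj ((σ₀ : ℂ) + y * I))))) := by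
        have hBB : ∫ y : ℝ, (a : ℂ) * (mellin f (-((σ₀ : ℂ) + y * I)) * conj (mellin g (-conj ((σ₀ : ℂ) + y * I))) * conj (c (conj ((σ₀ : ℂ) + y * I)))) =
            ∫ y : ℝ, mellin f (-((σ₀ : ℂ) + y * I)) * ((a : ℂ) * c ((σ₀ : ℂ) + y * I) * conj (mellin g (-conj ((σ₀ : ℂ) + y * I)))) :=
          integral_congr_ae (Eventually.of_forall fun y => by dsimp only; rw [hcr y]; ring)
        rw [mul_add, mul_left_comm (a : ℂ) κ, ← integral_const_mul (a : ℂ), hBB]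
    _ = κ * ∫ y : ℝ, mellin f (-((σ₀ : ℂ) + y * I)) *
          (conj (mellin g (conj ((σ₀ : ℂ) + y * I) - 2)) + (a : ℂ) * c ((σ₀ : ℂ) + y * I) * conj (mellin g (-conj ((σ₀ : ℂ) + y * I)))) := by
        rw [← integral_add hA hB]
        congr 1
        refine integral_congr_ae (Eventually.of_forall fun y => ?_)
        ring

end Summit.HodgeConjecture.HodgeConjecture.Cruxes.H413.K2E1MellinParsevalIntertwinedCMThree

end
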